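import Literature.NumberTheory.LFunctions.AlcantaraBodeOperatorProofs
import Literature.NumberTheory.LFunctions.RHWave0HardyProofs
import HarnessLib

/-!
# RH-EQUIVALENT (σ-INDEXED; the easy half PROVED for every `p`, the full statement PROVED for `p ≥ 2`) · Beurling's `L^p` closure theorem `Beurling1955_closure_iff` (Broughan Vol. 2 Thm 3.6): Hölder direction and the case `p ≥ 2`; nothing here bears on the truth of RH

LABEL (line 1): σ-INDEXED statements about zero-free half-planes `Re s > 1/p`, PROVED; at `p = 2`
this is an RH-EQUIVALENCE proved as an equivalence (the tree's `Beurling1955_closure_two_iff`), for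
`p > 2` both sides are FALSE (Hardy's theorem puts zeros on `Re s = 1/2 > 1/p`), for `1 < p < 2` only
the easy half "closure ⟹ zero-free" is proved here (the converse is Beurling's `L^p` analysis, not in
the tree). Nothing here asserts RH or its negation; nothing here bears on the truth of RH.

Literature-typing tranche `rh-lit-broughan-2` (gen 4): Broughan, *Equivalents of the Riemann
Hypothesis* Vol. 2, Ch. 3 §3.3 "Beurling's Theorem" pp. 29–35 (Thm 3.6, the "Nyman–Beurling
criterion": "`M` is dense in `L^p(0,1)` iff `ζ` has no zeros in `σ > 1/p`", read from the Core
preview of p. 23 by gen 3); the named fact `Beurling1955_closure_iff` (`BeurlingClosureLp.lean`,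
gen 0) is Beurling's own membership form "`1 ∈ C_p` iff no zeros in `Re s > 1/p`", `1 < p < ∞`.

## What is proved

* `riemannZeta_ne_zero_of_beurling_closure` — **the easy half for every `p > 1`** (Beurling 1955,
  first half of the proof; MR 17,15a): if `1` is an `L^p(0,1)`-limit of Beurling functions
  `f = Σ c_ν {θ_ν/x}` (`0 < θ_ν ≤ 1`, `Σ c_ν θ_ν = 0`), then `ζ(s) ≠ 0` for `Re s > 1/p`. Proof as in
  print: `∫₀¹ f(x) x^{s−1} dx = −ζ(s) Σ c_ν θ_ν^s / s` (Beurling's Mellin identity, the tree's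
  `alcantaraBodeOp_cpow` = `mellin_beurlingRhoTrunc_eq`), `∫₀¹ x^{s−1} dx = 1/s`, and Hölder with the
  conjugate exponent `q`: `x^{s−1} ∈ L^q(0,1)` exactly when `Re s > 1/p`; at a zero `s` this gives
  `|1/s| ≤ ‖1 − f‖_p ‖x^{s−1}‖_q → 0`, absurd.
* `Beurling1955_closure_iff_of_two_le` — **the named fact for all `p ≥ 2`**: at `p = 2` it is the
  tree's `Beurling1955_closure_two_iff` (gen 3); for `p > 2` the left side fails by Hardy's theorem
  (`hardy_infinite_zeros_on_critical_line_holds`: a zero `1/2 + iγ`, `1/2 > 1/p`) and the right side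
  fails by the easy half.

## References

* [Beurling1955] A. Beurling, *A closure problem related to the Riemann zeta-function*, Proc. Nat.
  Acad. Sci. 41 (1955) 312–314, Theorem (as in MR 17,15a).
* [Broughan2017] K. Broughan, *Equivalents of the Riemann Hypothesis* Vol. 2, CUP 2017, Thm 3.6.
-/

noncomputable section

open MeasureTheory Set Complex Filter Topology
open scoped ENNReal

namespace Literature.NumberTheory.LFunctions

/-- Beurling's Mellin identity for a function of class `C` at a zero of `ζ`: if `ζ(s) = 0`,
`0 < Re s`, `s ≠ 1`, then `∫₀¹ f(x) x^{s−1} dx = 0` for every Beurling function `f` (the `1/(s−1)`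
terms cancel by `Σ c_ν θ_ν = 0`, the `ζ(s)` terms vanish). [cite: Beurling1955, proof (∫₀¹ f x^{s−1} dx = −ζ(s)Σc_νθ_ν^s/s; MR 17,15a)] -/
theorem integral_beurlingFunction_mul_cpow_eq_zero {n : ℕ} {θ c : Fin n → ℝ} (h : IsBeurlingData θ c)
    {s : ℂ} (hs : 0 < s.re) (hs1 : s ≠ 1) (hζ : riemannZeta s = 0) :
    ∫ x in Ioo (0 : ℝ) 1, (beurlingFunction θ c x : ℂ) * (x : ℂ) ^ (s - 1) = 0 := by
  -- integrability of each term `x^{s-1} {θ/x}`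
  have hi : IntegrableOn (fun x : ℝ => (x : ℂ) ^ (s - 1)) (Ioo (0 : ℝ) 1) := by
    have := (intervalIntegral.intervalIntegrable_cpow' (a := 0) (b := 1) (r := s - 1)
      (by simp; linarith)).1
    exact this.mono_set Ioo_subset_Ioc_self
  have hb : ∀ (β : ℝ) (x : ℝ), ‖((Int.fract (β / x) : ℝ) : ℂ)‖ ≤ 1 := fun β x => by
    rw [Complex.norm_real, Real.norm_eq_abs, abs_of_nonneg (Int.fract_nonneg _)]
    exact (Int.fract_lt_one _).le
  have hmeasF : ∀ β : ℝ, AEStronglyMeasurable (fun x : ℝ => ((Int.fract (β / x) : ℝ) : ℂ))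
      (volume.restrict (Ioo (0 : ℝ) 1)) := fun β =>
    (Complex.measurable_ofReal.comp (measurable_fract.comp
      (measurable_const.div measurable_id))).aestronglyMeasurable
  have hI : ∀ i, IntegrableOn (fun x : ℝ => (x : ℂ) ^ (s - 1) * ((Int.fract (θ i / x) : ℝ) : ℂ))
      (Ioo (0 : ℝ) 1) := fun i => hi.mul_bdd (hmeasF (θ i)) (ae_of_all _ (hb (θ i)))
  have e : (fun x : ℝ => (beurlingFunction θ c x : ℂ) * (x : ℂ) ^ (s - 1)) =
      fun x : ℝ => ∑ i, (c i : ℂ) * (((x : ℝ) : ℂ) ^ (s - 1) * ((Int.fract (θ i / x) : ℝ) : ℂ)) := by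
    funext x
    simp only [beurlingFunction]
    push_cast
    rw [Finset.sum_mul]
    exact Finset.sum_congr rfl fun i _ => by ring
  rw [e, integral_finsetSum _ fun i _ => (hI i).const_mul _]
  have hA : ∀ i, ∫ x in Ioo (0 : ℝ) 1, (x : ℂ) ^ (s - 1) * ((Int.fract (θ i / x) : ℝ) : ℂ) =
      θ i / (s - 1) - (θ i : ℂ) ^ s * riemannZeta s / s := fun i =>
    alcantaraBodeOp_cpow (h.1 i).1 (h.1 i).2 hs hs1
  simp_rw [integral_const_mul, hA, hζ, mul_zero, zero_div, sub_zero]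
  have hsum : ∑ i, (c i : ℂ) * ((θ i : ℂ) / (s - 1)) = (∑ i, c i * θ i : ℝ) / (s - 1) := by
    push_cast
    rw [Finset.sum_div]
    exact Finset.sum_congr rfl fun i _ => by ring
  rw [hsum, h.2]
  simp

/-- `x ↦ x^{s−1}` lies in `L^q(0,1)` when `(Re s − 1) q > −1`, i.e. `Re s > 1 − 1/q = 1/p` for the
conjugate exponent. [cite: Beurling1955, proof (x^{s−1} ∈ L^q(0,1) iff Re s > 1/p; MR 17,15a)] -/
theorem memLp_cpow_Ioo_of_lt {s : ℂ} {q : ℝ} (hq : 0 < q) (hσ : 1 - 1 / q < s.re) :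
    MemLp (fun x : ℝ => (x : ℂ) ^ (s - 1)) (ENNReal.ofReal q) (volume.restrict (Ioo (0 : ℝ) 1)) := by
  have hgm : AEStronglyMeasurable (fun x : ℝ => (x : ℂ) ^ (s - 1))
      (volume.restrict (Ioo (0 : ℝ) 1)) :=
    (Complex.measurable_ofReal.pow_const _).aestronglyMeasurable
  have hq0 : ENNReal.ofReal q ≠ 0 := by simpa using hq
  refine ⟨hgm, ?_⟩
  rw [eLpNorm_eq_lintegral_rpow_enorm_toReal hq0 ENNReal.ofReal_ne_top, ENNReal.toReal_ofReal hq.le]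
  refine ENNReal.rpow_lt_top_of_nonneg (by positivity) (ne_of_lt ?_)
  -- `∫₀¹ x^{(σ−1)q} dx < ∞` since `(σ−1) q > −1`
  have hexp : -1 < (s.re - 1) * q := by
    have : (1 - 1 / q) * q = q - 1 := by field_simp
    nlinarith [mul_lt_mul_of_pos_right hσ hq]
  have hI : IntegrableOn (fun x : ℝ ↦ x ^ ((s.re - 1) * q)) (Ioo 0 1) volume :=
    (intervalIntegral.intervalIntegrable_rpow' (a := 0) (b := 1) (r := (s.re - 1) * q) hexp).1
      |>.mono_set Ioo_subset_Ioc_self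
  have hI' := hI.2
  rw [hasFiniteIntegral_iff_enorm] at hI'
  refine lt_of_le_of_lt (le_of_eq ?_) hI'
  refine setLIntegral_congr_fun measurableSet_Ioo fun x hx => ?_
  rw [← ofReal_norm, norm_cpow_eq_rpow_re_of_pos hx.1, sub_re, one_re,
    ENNReal.ofReal_rpow_of_pos (Real.rpow_pos_of_pos hx.1 _), ← Real.rpow_mul hx.1.le,
    Real.enorm_eq_ofReal (Real.rpow_nonneg hx.1.le _)]

/-- **Beurling's theorem, easy half, for every `p > 1`** (PROVED): if `1` is an `L^p(0,1)`-limit of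
functions of Beurling's class `C`, then `ζ(s) ≠ 0` for `Re s > 1/p`.
[cite: Beurling1955, Theorem, direction "1 ∈ C_p ⟹ no zeros in Re s > 1/p" (MR 17,15a)] [cite: Broughan2017, Vol. 2 Thm 3.6] -/
theorem riemannZeta_ne_zero_of_beurling_closure {p : ℝ} (hp : 1 < p)
    (h : ∀ ε : ℝ, 0 < ε → ∃ (n : ℕ) (θ c : Fin n → ℝ), IsBeurlingData θ c ∧
      eLpNorm (fun x : ℝ ↦ 1 - beurlingFunction θ c x) (ENNReal.ofReal p)
        (volume.restrict (Ioo (0 : ℝ) 1)) < ENNReal.ofReal ε) :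
    ∀ s : ℂ, 1 / p < s.re → riemannZeta s ≠ 0 := by
  intro s hσp hζ
  have hp0 : 0 < p := by linarith
  -- zeros have `Re s < 1`
  by_cases hs1' : 1 ≤ s.re
  · exact riemannZeta_ne_zero_of_one_le_re hs1' hζ
  rw [not_le] at hs1'
  have hre : 0 < s.re := lt_trans (by positivity) hσp
  have hs0 : s ≠ 0 := fun h0 ↦ by simp [h0] at hre
  have hs1 : s ≠ 1 := fun h1 ↦ by simp [h1] at hs1'
  -- the conjugate exponent and the test function
  set q : ℝ := Real.conjExponent p with hq
  have hpq : p.HolderConjugate q := Real.HolderConjugate.conjExponent hp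
  have hq0 : 0 < q := hpq.symm.pos
  have hσq : 1 - 1 / q < s.re := by
    have : 1 / p + 1 / q = 1 := by
      simpa [one_div] using hpq.inv_add_inv_eq_one
    linarith
  have hg : MemLp (fun x : ℝ => (x : ℂ) ^ (s - 1)) (ENNReal.ofReal q)
      (volume.restrict (Ioo (0 : ℝ) 1)) := memLp_cpow_Ioo_of_lt hq0 hσq
  set Cq : ℝ := (∫ x in Ioo (0 : ℝ) 1, ‖(x : ℂ) ^ (s - 1)‖ ^ q) ^ (1 / q) with hCq
  have hCq0 : 0 ≤ Cq := by positivity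
  have hi : IntegrableOn (fun x : ℝ => (x : ℂ) ^ (s - 1)) (Ioo (0 : ℝ) 1) := by
    have := (intervalIntegral.intervalIntegrable_cpow' (a := 0) (b := 1) (r := s - 1)
      (by simp; linarith)).1
    exact this.mono_set Ioo_subset_Ioc_self
  -- key estimate: `‖1/s‖ ≤ ε Cq` for every `ε > 0`
  have key : ∀ ε : ℝ, 0 < ε → ‖(1 : ℂ) / s‖ ≤ ε * Cq := by
    intro ε hε
    obtain ⟨n, θ, c, hθc, hlt⟩ := h ε hε
    set B : ℝ → ℝ := beurlingFunction θ c with hB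
    have hBm : Measurable B := by
      simp only [hB]
      unfold beurlingFunction
      exact Finset.measurable_sum _ fun i _ =>
        measurable_const.mul (measurable_fract.comp (measurable_const.div measurable_id))
    have hBbdd : ∀ x, ‖B x‖ ≤ ∑ i, ‖c i‖ := by
      intro x
      simp only [hB, beurlingFunction]
      refine (norm_sum_le _ _).trans (Finset.sum_le_sum fun i _ => ?_)
      rw [norm_mul, Real.norm_eq_abs (Int.fract _), abs_of_nonneg (Int.fract_nonneg _)]
      calc ‖c i‖ * Int.fract (θ i / x) ≤ ‖c i‖ * 1 := by gcongr; exact (Int.fract_lt_one _).le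
        _ = ‖c i‖ := mul_one _
    have hDm : MemLp (fun x : ℝ => ((1 - B x : ℝ) : ℂ)) (ENNReal.ofReal p)
        (volume.restrict (Ioo (0 : ℝ) 1)) :=
      MemLp.of_bound ((Complex.measurable_ofReal.comp (measurable_const.sub hBm)).aestronglyMeasurable)
        (1 + ∑ i, ‖c i‖) (ae_of_all _ fun x => by
          rw [Complex.norm_real]
          exact (norm_sub_le _ _).trans (by simpa using hBbdd x))
    -- `1/s = ∫ (1 − B) x^{s−1}`
    have hBi : IntegrableOn (fun x : ℝ => (B x : ℂ) * (x : ℂ) ^ (s - 1)) (Ioo (0 : ℝ) 1) := by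
      have : IntegrableOn (fun x : ℝ => ((x : ℝ) : ℂ) ^ (s - 1) * (B x : ℂ)) (Ioo (0 : ℝ) 1) :=
        hi.mul_bdd ((Complex.measurable_ofReal.comp hBm).aestronglyMeasurable)
          (ae_of_all _ fun x => by rw [Complex.norm_real]; exact hBbdd x)
      exact this.congr (ae_of_all _ fun x => by ring)
    have hId : (1 : ℂ) / s = ∫ x in Ioo (0 : ℝ) 1, ((1 - B x : ℝ) : ℂ) * (x : ℂ) ^ (s - 1) := by
      have e : (fun x : ℝ => ((1 - B x : ℝ) : ℂ) * (x : ℂ) ^ (s - 1)) =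
          fun x : ℝ => ((x : ℝ) : ℂ) ^ (s - 1) - (B x : ℂ) * ((x : ℝ) : ℂ) ^ (s - 1) := by
        funext x; push_cast; ring
      rw [e, integral_sub hi hBi, integral_cpow_Ioo_zero_one hre,
        integral_beurlingFunction_mul_cpow_eq_zero hθc hre hs1 hζ, sub_zero]
    -- Hölder
    have hH := integral_mul_norm_le_Lp_mul_Lq hpq hDm hg
    have hnorm : ‖(1 : ℂ) / s‖ ≤ (∫ x in Ioo (0 : ℝ) 1, ‖((1 - B x : ℝ) : ℂ)‖ ^ p) ^ (1 / p) * Cq := by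
      rw [hId]
      refine (norm_integral_le_integral_norm _).trans ?_
      have e : (fun x : ℝ => ‖((1 - B x : ℝ) : ℂ) * (x : ℂ) ^ (s - 1)‖) =
          fun x => ‖((1 - B x : ℝ) : ℂ)‖ * ‖(x : ℂ) ^ (s - 1)‖ := funext fun x => norm_mul _ _
      rw [e]
      exact hH
    -- the `L^p` distance is `< ε`
    have hε : (∫ x in Ioo (0 : ℝ) 1, ‖((1 - B x : ℝ) : ℂ)‖ ^ p) ^ (1 / p) < ε := by
      have := hDm.eLpNorm_eq_integral_rpow_norm (by simpa using hp0) ENNReal.ofReal_ne_top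
      rw [ENNReal.toReal_ofReal hp0.le] at this
      have hlt' : eLpNorm (fun x : ℝ => ((1 - B x : ℝ) : ℂ)) (ENNReal.ofReal p)
          (volume.restrict (Ioo (0 : ℝ) 1)) < ENNReal.ofReal ε := by
        refine lt_of_le_of_lt (le_of_eq (eLpNorm_congr_enorm_ae (ae_of_all _ fun x => ?_))) hlt
        rw [enorm_eq_nnnorm, enorm_eq_nnnorm, Complex.nnnorm_real]
      rw [this, ENNReal.ofReal_lt_ofReal_iff hε] at hlt'
      simpa [one_div] using hlt'
    calc ‖(1 : ℂ) / s‖ ≤ (∫ x in Ioo (0 : ℝ) 1, ‖((1 - B x : ℝ) : ℂ)‖ ^ p) ^ (1 / p) * Cq := hnorm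
      _ ≤ ε * Cq := by gcongr
  -- conclusion: `1/s = 0`, absurd
  have hnorm0 : ‖(1 : ℂ) / s‖ = 0 := by
    refine le_antisymm ?_ (norm_nonneg _)
    by_contra hlt
    rw [not_le] at hlt
    have := key (‖(1 : ℂ) / s‖ / (2 * (Cq + 1))) (by positivity)
    have hC : ‖(1 : ℂ) / s‖ / (2 * (Cq + 1)) * Cq < ‖(1 : ℂ) / s‖ := by
      rw [div_mul_eq_mul_div, div_lt_iff₀ (by positivity)]
      nlinarith
    linarith
  rw [norm_eq_zero, div_eq_zero_iff] at hnorm0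
  exact hnorm0.elim one_ne_zero hs0

/-- **`Beurling1955_closure_iff` for every `p ≥ 2`** (PROVED): at `p = 2` this is Nyman's theorem in
Beurling's form (`Beurling1955_closure_two_iff`); for `p > 2` both sides are false — Hardy's zeros
`1/2 + iγ` lie in `Re s > 1/p`, and by the easy half no Beurling functions can then approximate `1`
in `L^p(0,1)`. [cite: Beurling1955, Theorem (MR 17,15a), cases p ≥ 2] [cite: Broughan2017, Vol. 2 Thm 3.6] -/
theorem Beurling1955_closure_iff_of_two_le {p : ℝ} (hp : 2 ≤ p) :
    (∀ s : ℂ, 1 / p < s.re → riemannZeta s ≠ 0) ↔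
      ∀ ε : ℝ, 0 < ε → ∃ (n : ℕ) (θ c : Fin n → ℝ), IsBeurlingData θ c ∧
        eLpNorm (fun x : ℝ ↦ 1 - beurlingFunction θ c x) (ENNReal.ofReal p)
          (volume.restrict (Ioo (0 : ℝ) 1)) < ENNReal.ofReal ε := by
  rcases hp.eq_or_lt with rfl | hp2
  · have h2 : ENNReal.ofReal (2 : ℝ) = 2 := by simp
    rw [h2]
    exact Beurling1955_closure_two_iff
  · -- `p > 2`: both sides are false
    have hp1 : 1 < p := by linarith
    obtain ⟨γ, hγ⟩ := hardy_infinite_zeros_on_critical_line_holds.nonempty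
    have hzero : riemannZeta (1 / 2 + γ * I) = 0 := hγ
    have hre : 1 / p < (1 / 2 + γ * I : ℂ).re := by
      have : (1 / 2 + γ * I : ℂ).re = 1 / 2 := by simp
      rw [this, one_div_lt_one_div (by linarith) (by norm_num)]
      exact hp2
    constructor
    · intro hL
      exact absurd hzero (hL _ hre)
    · intro hR
      exact absurd hzero (riemannZeta_ne_zero_of_beurling_closure hp1 hR _ hre)

end Literature.NumberTheory.LFunctions
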